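/-
Copyright (c) 2026. All rights reserved.
Released under Apache 2.0 license as described in the file LICENSE.
-/
import Summits.Langlands.Langlands.Theorems.SoloInformedGLOneGaloisToAutomorphic
import Summits.Langlands.Langlands.Theorems.SoloInformedRepairR3plus
import HarnessLib

/-!
# The R3⁺-repaired `n = 1` conjunct is decided by three ε-free statements — all theorems in print

File Λ23 of the programme `solo-Langlands-informed`; the counterpart, for the seat's re-scoped statement
`R3plus.GlobalLanglandsCorrespondenceGLnR3plus` (`SoloInformedRepairR3plus`: the summit with its
`v ∣ ℓ` Weil–Deligne conjunct replaced by Hodge–Tate compatibility, Buzzard–Gee Rem. 3.2.3), of Λ21/Λ22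
(`automorphicToGalois_one_iff_pst`, `galoisToAutomorphic_one_iff`,
`globalLanglandsCorrespondenceGLn_one_iff_wd_of_facts`) for the summit as typed.

* §1 `correspondsR3plus_iff_eq_weilRep`: for an automorphic `π` of `GL₁/K` with algebraic Hecke
  character `θ`, `CorrespondsR3plus 𝓡 ι π ρ ⟺ ρ = r_{θ,ι} ∧ (Hodge–Tate compatibility of `(π, ρ)` at
  every `v ∣ ℓ`)` — Satake matching a.e. pins `ρ` (Λ21) and local–global compatibility at every
  `v ∤ ℓ` is a theorem (Λ21).
* §2 ★ `automorphicToGaloisR3plus_one_iff_weilRep`: (A⁺)₁ ⟺ for every cuspidal `π` with Hecke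
  character `θ` (algebraic, any witnesses) and every `ℓ, ι`: the pinned datum declares `r_{θ,ι}` de
  Rham at every `v ∣ ℓ` AND `(π, r_{θ,ι})` is Hodge–Tate compatible at every `v ∣ ℓ`.
  ★ `galoisToAutomorphicR3plus_one_iff_weilRep`: (B⁺)₁ ⟺ every framed rank-one `ρ` declared de Rham
  at every `v ∣ ℓ` is some `r_{θ,ι}` with a cuspidal `π` of Hecke character `θ` Hodge–Tate compatible
  with `ρ` above `ℓ`.
* §3 ★★ `globalLanglandsCorrespondenceGLnR3plus_one_iff_weilRep`: the repaired `n = 1` conjunct ⟺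
  (dR₁ ∧ HT₁) ∧ (FM₁), where dR₁ = "the pinned datum declares every `r_{θ,ι}|Γ_{K_v}` de Rham",
  HT₁ = "every cuspidal `π` with Hecke character `θ` is Hodge–Tate compatible with `r_{θ,ι}` at every
  `v ∣ ℓ`", FM₁ = "every pinned-de Rham framed character is a Weil character".  ALL THREE ARE
  STATEMENTS ABOUT CONSTRUCTED OBJECTS — the pinned datum enters dR₁/FM₁ only through its de Rham
  predicate and HT₁ only through its `ℚ_ℓ`-structure and period ring, which are unconditionally the
  canonical ones (`isDeRhamFramed_pst_iff_bdR`, `hodgeTateCompatibleAt_iff_bdR`) — and all three are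
  theorems in print (Serre III §2.3 + App. A / Conrad App. B.4; Serre III §1.1 + III.A, with the
  sign conventions aligned in `SoloInformedRepairR3plus`, `HT(ε_ℓ) = -1` on both sides; Patrikis
  Prop. 2.2.1).  ★★ `globalLanglandsCorrespondenceGLnR3plus_one_iff_ht_of_facts`: granting the two
  that the tree already keeps as named facts (`HeckeCharacter.exists_lAdic_isDeRhamFramed`,
  `FramedGaloisRep.exists_heckeCharacter_of_isDeRhamFramed`), the repaired `n = 1` conjunct ⟺ HT₁;
  ★★★ `globalLanglandsCorrespondenceGLnR3plus_one_of_facts`: granting all three, IT HOLDS, for every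
  number field `K` and every reciprocity datum `𝓡`.

CONTRAST (the statement finding of the programme, kernel form): by Λ22
`globalLanglandsCorrespondenceGLn_one_iff_wd_of_facts`, granting the same named facts the summit's
OWN `n = 1` conjunct is equivalent to the Weil–Deligne VALUE of the `Classical.epsilon`-chosen
`fontainePstAdicCompletion v ℓ hv` on Weil characters — a property its specification leaves
undetermined (`SoloInformedPinExclusionSpec`); the repaired conjunct is equivalent to an ε-free
theorem of the literature.  No definitions.

Citations: [BuzzardGeeLMS2014] Conj. 3.2.1–3.2.2, Rem. 3.2.3, Rem. 3.2.5; [SerreAbelianLadic1968]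
III §1.1, §2.3, App. A; [Patrikis2019] Prop. 2.2.1; [Conrad2011LiftingGlobal] App. B Prop. B.4;
[FontaineMazurGeometric1995] Conj. 1; [Weil1956] §§1–2; [Clozel1990] §3.3; [FlathCorvallis1979] Thm 3–4.
-/

noncomputable section
open scoped MatrixGroups Matrix Classical Polynomial NumberField
open NumberField IsDedekindDomain Field Polynomial Filter
open Literature.NumberTheory.Automorphic Literature.NumberTheory.GaloisRepresentations

namespace Summit.Langlands.Langlands.Theorems

namespace GLOneRigidity

section R3plusOne

variable {K : Type} [Field K] [NumberField K] {hcpt : isCompact_glFiniteIntegralLevel 1 K}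
  {ℓ : ℕ} [Fact ℓ.Prime] {θ : HeckeCharacter K} {p q : InfinitePlace K → ℤ}
  {T : Finset (HeightOneSpectrum (𝓞 K))} {e : HeightOneSpectrum (𝓞 K) → ℕ}

/-! ### §1 `CorrespondsR3plus` on `GL₁` -/

/-- **On `GL₁`, R3⁺-correspondence with an automorphic `π` of algebraic Hecke character `θ` is
`ρ = r_{θ,ι}` plus Hodge–Tate compatibility above `ℓ`**: the Satake clause a.e. pins `ρ` to Weil's
character (Λ21 `eventually_satakeFrobCompatibleAt_iff_eq_weilRep`), and local–global compatibility at
every `v ∤ ℓ` holds for `r_{θ,ι}` (Λ21 `localGlobalCompatibleAt_weilRep_away`).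
[cite: BuzzardGeeLMS2014, Conj. 3.2.1 and Rem. 3.2.3] [cite: Weil1956, §§1–2] -/
theorem correspondsR3plus_iff_eq_weilRep (𝓡 : ReciprocityData K) (ι : PadicAlgCl ℓ ≃+* ℂ)
    (π : AutomorphicRepData (AutomorphyDatum.gl 1 K hcpt))
    (hχ : ∀ (g : (AdelicGroupData.gl 1 K).Adelic), ∀ φ ∈ π.W,
      rightTranslation (AdelicGroupData.gl 1 K) g φ -
        ((θ (Matrix.GeneralLinearGroup.det g) : ℂˣ) : ℂ) • φ ∈ π.W')
    (hinf : θ.HasInfinityType p q) (hmod : HeckeCharacter.IsModulus θ T e)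
    (ρ : FramedGaloisRep K (PadicAlgCl ℓ) 1) :
    R3plus.CorrespondsR3plus 𝓡 ι π ρ ↔
      ρ = hinf.weilRep hmod ι ∧
        ∀ (v : HeightOneSpectrum (𝓞 K)) (hv : ((ℓ : ℕ) : 𝓞 K) ∈ v.asIdeal),
          R3plus.HodgeTateCompatibleAt 𝓡 ι π ρ v hv := by
  refine ⟨fun h => ⟨(eventually_satakeFrobCompatibleAt_iff_eq_weilRep ι π hχ hinf hmod ρ).mp h.1,
    h.2.2⟩, fun h => ?_⟩
  obtain ⟨rfl, hHT⟩ := h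
  exact ⟨eventually_satakeFrobCompatibleAt_weilRep ι π hχ hinf hmod,
    fun v hv => localGlobalCompatibleAt_weilRep_away 𝓡 ι π hχ hinf hmod hv, hHT⟩

/-! ### §2 The two repaired clauses for `n = 1` -/

/-- ★ **Clause (A⁺) for `n = 1`.**  `AutomorphicToGaloisR3plus 1 𝓡 hcpt` holds iff for every cuspidal
`π` of `GL₁/K` on which the ideles act through `θ ∘ det` (such `θ` is then algebraic, and every
algebraic `θ` occurs: `exists_cuspidal_detTwist_glOne`), all witnesses `hinf, hmod`, every `ℓ` and
`ι`: the pinned datum declares `r_{θ,ι}|Γ_{K_v}` de Rham at every `v ∣ ℓ`, and `(π, r_{θ,ι})` is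
Hodge–Tate compatible at every `v ∣ ℓ`.  Irreducibility, unramifiedness a.e. and uniqueness up to
conjugacy are automatic in rank one. [cite: BuzzardGeeLMS2014, Conj. 3.2.1–3.2.2 and Rem. 3.2.3]
[cite: Clozel1990, §3.3] [cite: SerreAbelianLadic1968, III §2.3] -/
theorem automorphicToGaloisR3plus_one_iff_weilRep (𝓡 : ReciprocityData K) :
    R3plus.AutomorphicToGaloisR3plus 1 𝓡 hcpt ↔
      ∀ (π : CuspidalAutomorphicRepData 1 K hcpt) (θ : HeckeCharacter K),
        (∀ (g : (AdelicGroupData.gl 1 K).Adelic), ∀ φ ∈ π.1.W,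
          rightTranslation (AdelicGroupData.gl 1 K) g φ -
            ((θ (Matrix.GeneralLinearGroup.det g) : ℂˣ) : ℂ) • φ ∈ π.1.W') →
        ∀ (p q : InfinitePlace K → ℤ) (hinf : θ.HasInfinityType p q)
          (T : Finset (HeightOneSpectrum (𝓞 K))) (e : HeightOneSpectrum (𝓞 K) → ℕ)
          (hmod : HeckeCharacter.IsModulus θ T e) (ℓ : ℕ) [Fact ℓ.Prime] (ι : PadicAlgCl ℓ ≃+* ℂ),
          (∀ (v : HeightOneSpectrum (𝓞 K)) (hv : ((ℓ : ℕ) : 𝓞 K) ∈ v.asIdeal),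
            (𝓡.pst ℓ v hv).IsDeRhamFramed ((hinf.weilRep hmod ι).toLocal v)) ∧
          ∀ (v : HeightOneSpectrum (𝓞 K)) (hv : ((ℓ : ℕ) : 𝓞 K) ∈ v.asIdeal),
            R3plus.HodgeTateCompatibleAt 𝓡 ι π.1 (hinf.weilRep hmod ι) v hv := by
  constructor
  · intro hA π θ hχ p q hinf T e hmod ℓ _ ι
    obtain ⟨ρ, -, hgeo, hcor, -⟩ :=
      hA π (isLAlgebraic_of_hasInfinityType_heckeCharacter_glOne π.1 hχ hinf) ℓ ι
    obtain ⟨rfl, hHT⟩ := (correspondsR3plus_iff_eq_weilRep 𝓡 ι π.1 hχ hinf hmod ρ).mp hcor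
    exact ⟨hgeo.2, hHT⟩
  · intro h π hL ℓ _ ι
    obtain ⟨θ, hχ⟩ := π.1.exists_heckeCharacter_glOne
    obtain ⟨T₀, hT₀, hL⟩ := hL
    obtain ⟨p, q, hinf⟩ := π.1.exists_hasInfinityType_heckeCharacter_glOne hχ hT₀
      ((InfinityType.isCAlgebraic_iff_isLAlgebraic_of_odd odd_one T₀).mpr hL)
    obtain ⟨T, e, hmod⟩ := θ.exists_isModulus
    obtain ⟨hdR, hHT⟩ := h π θ hχ p q hinf T e hmod ℓ ι
    refine ⟨hinf.weilRep hmod ι, isIrreducible_of_finrank_eq_one' _ (Module.finrank_fin_fun _),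
      (isGeometricFramed_iff_isDeRhamFramed_of_rank_one 𝓡 _).mpr hdR,
      (correspondsR3plus_iff_eq_weilRep 𝓡 ι π.1 hχ hinf hmod _).mpr ⟨rfl, hHT⟩, fun ρ' h' => ?_⟩
    obtain ⟨rfl, -⟩ := (correspondsR3plus_iff_eq_weilRep 𝓡 ι π.1 hχ hinf hmod ρ').mp h'
    exact IsConjugate.refl _

/-- ★ **Clause (B⁺) for `n = 1`.**  `GaloisToAutomorphicR3plus 1 𝓡 hcpt` holds iff every framed
`ρ : Γ_K → GL₁(ℚ̄_ℓ)` that the pinned datum declares de Rham at every `v ∣ ℓ` is a Weil character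
`r_{θ,ι}` for which some cuspidal `π` with Hecke character `θ` is Hodge–Tate compatible with `ρ` above
`ℓ`. [cite: FontaineMazurGeometric1995, Conj. 1] [cite: BuzzardGeeLMS2014, Conj. 3.2.2 and Rem. 3.2.3]
[cite: Patrikis2019, Prop. 2.2.1] -/
theorem galoisToAutomorphicR3plus_one_iff_weilRep (𝓡 : ReciprocityData K) :
    R3plus.GaloisToAutomorphicR3plus 1 𝓡 hcpt ↔
      ∀ (ℓ : ℕ) [Fact ℓ.Prime] (ι : PadicAlgCl ℓ ≃+* ℂ) (ρ : FramedGaloisRep K (PadicAlgCl ℓ) 1),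
        (∀ (v : HeightOneSpectrum (𝓞 K)) (hv : ((ℓ : ℕ) : 𝓞 K) ∈ v.asIdeal),
          (𝓡.pst ℓ v hv).IsDeRhamFramed (ρ.toLocal v)) →
        ∃ (θ : HeckeCharacter K) (p q : InfinitePlace K → ℤ) (hinf : θ.HasInfinityType p q)
          (T : Finset (HeightOneSpectrum (𝓞 K))) (e : HeightOneSpectrum (𝓞 K) → ℕ)
          (hmod : HeckeCharacter.IsModulus θ T e),
          ρ = hinf.weilRep hmod ι ∧
          ∃ π : CuspidalAutomorphicRepData 1 K hcpt,
            (∀ (g : (AdelicGroupData.gl 1 K).Adelic), ∀ φ ∈ π.1.W,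
              rightTranslation (AdelicGroupData.gl 1 K) g φ -
                ((θ (Matrix.GeneralLinearGroup.det g) : ℂˣ) : ℂ) • φ ∈ π.1.W') ∧
            ∀ (v : HeightOneSpectrum (𝓞 K)) (hv : ((ℓ : ℕ) : 𝓞 K) ∈ v.asIdeal),
              R3plus.HodgeTateCompatibleAt 𝓡 ι π.1 ρ v hv := by
  constructor
  · intro hB ℓ _ ι ρ hdR
    obtain ⟨π, hL, hcor⟩ := hB ℓ ι ρ (isIrreducible_of_finrank_eq_one' _ (Module.finrank_fin_fun _))
      ((isGeometricFramed_iff_isDeRhamFramed_of_rank_one 𝓡 ρ).mpr hdR)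
    obtain ⟨θ, hχ⟩ := π.1.exists_heckeCharacter_glOne
    obtain ⟨T₀, hT₀, hL⟩ := hL
    obtain ⟨p, q, hinf⟩ := π.1.exists_hasInfinityType_heckeCharacter_glOne hχ hT₀
      ((InfinityType.isCAlgebraic_iff_isLAlgebraic_of_odd odd_one T₀).mpr hL)
    obtain ⟨T, e, hmod⟩ := θ.exists_isModulus
    obtain ⟨hρ, hHT⟩ := (correspondsR3plus_iff_eq_weilRep 𝓡 ι π.1 hχ hinf hmod ρ).mp hcor
    exact ⟨θ, p, q, hinf, T, e, hmod, hρ, π, hχ, hHT⟩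
  · intro h ℓ _ ι ρ _ hgeo
    obtain ⟨θ, p, q, hinf, T, e, hmod, hρ, π, hχ, hHT⟩ := h ℓ ι ρ hgeo.2
    exact ⟨π, isLAlgebraic_of_hasInfinityType_heckeCharacter_glOne π.1 hχ hinf,
      (correspondsR3plus_iff_eq_weilRep 𝓡 ι π.1 hχ hinf hmod ρ).mpr ⟨hρ, hHT⟩⟩

/-! ### §3 The repaired `n = 1` conjunct -/

/-- ★★ **The R3⁺-repaired `n = 1` conjunct over `K` ⟺ (dR₁ ∧ HT₁) ∧ FM₁** — three statements in
which the pinned datum enters only through its de Rham predicate (dR₁, FM₁) or its `ℚ_ℓ`-structure and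
period ring (HT₁), i.e. unconditionally through the CONSTRUCTED `B_dR(K_v)`
(`R3plus.isDeRhamFramed_pst_iff_bdR`, `R3plus.hodgeTateCompatibleAt_iff_bdR`); all three are theorems
in print. [cite: BuzzardGeeLMS2014, Conj. 3.2.1–3.2.2 and Rem. 3.2.3]
[cite: SerreAbelianLadic1968, III §1.1, §2.3 and App. A] [cite: Patrikis2019, Prop. 2.2.1] -/
theorem globalLanglandsCorrespondenceGLnR3plus_one_iff_weilRep (𝓡 : ReciprocityData K) :
    R3plus.GlobalLanglandsCorrespondenceGLnR3plus 1 K 𝓡 hcpt ↔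
      (∀ (π : CuspidalAutomorphicRepData 1 K hcpt) (θ : HeckeCharacter K),
        (∀ (g : (AdelicGroupData.gl 1 K).Adelic), ∀ φ ∈ π.1.W,
          rightTranslation (AdelicGroupData.gl 1 K) g φ -
            ((θ (Matrix.GeneralLinearGroup.det g) : ℂˣ) : ℂ) • φ ∈ π.1.W') →
        ∀ (p q : InfinitePlace K → ℤ) (hinf : θ.HasInfinityType p q)
          (T : Finset (HeightOneSpectrum (𝓞 K))) (e : HeightOneSpectrum (𝓞 K) → ℕ)
          (hmod : HeckeCharacter.IsModulus θ T e) (ℓ : ℕ) [Fact ℓ.Prime] (ι : PadicAlgCl ℓ ≃+* ℂ)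
          (v : HeightOneSpectrum (𝓞 K)) (hv : ((ℓ : ℕ) : 𝓞 K) ∈ v.asIdeal),
          (𝓡.pst ℓ v hv).IsDeRhamFramed ((hinf.weilRep hmod ι).toLocal v) ∧
            R3plus.HodgeTateCompatibleAt 𝓡 ι π.1 (hinf.weilRep hmod ι) v hv) ∧
      ∀ (ℓ : ℕ) [Fact ℓ.Prime] (ι : PadicAlgCl ℓ ≃+* ℂ) (ρ : FramedGaloisRep K (PadicAlgCl ℓ) 1),
        (∀ (v : HeightOneSpectrum (𝓞 K)) (hv : ((ℓ : ℕ) : 𝓞 K) ∈ v.asIdeal),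
          (𝓡.pst ℓ v hv).IsDeRhamFramed (ρ.toLocal v)) →
        ∃ (θ : HeckeCharacter K) (p q : InfinitePlace K → ℤ) (hinf : θ.HasInfinityType p q)
          (T : Finset (HeightOneSpectrum (𝓞 K))) (e : HeightOneSpectrum (𝓞 K) → ℕ)
          (hmod : HeckeCharacter.IsModulus θ T e), ρ = hinf.weilRep hmod ι := by
  unfold R3plus.GlobalLanglandsCorrespondenceGLnR3plus
  rw [automorphicToGaloisR3plus_one_iff_weilRep 𝓡, galoisToAutomorphicR3plus_one_iff_weilRep 𝓡]
  constructor
  · intro h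
    refine ⟨fun π θ hχ p q hinf T e hmod ℓ _ ι v hv => ?_, fun ℓ _ ι ρ hdR => ?_⟩
    · obtain ⟨hdR, hHT⟩ := h.1 π θ hχ p q hinf T e hmod ℓ ι
      exact ⟨hdR v hv, hHT v hv⟩
    · obtain ⟨θ, p, q, hinf, T, e, hmod, hρ, -⟩ := h.2 ℓ ι ρ hdR
      exact ⟨θ, p, q, hinf, T, e, hmod, hρ⟩
  · intro h
    refine ⟨fun π θ hχ p q hinf T e hmod ℓ _ ι =>
      ⟨fun v hv => (h.1 π θ hχ p q hinf T e hmod ℓ ι v hv).1,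
        fun v hv => (h.1 π θ hχ p q hinf T e hmod ℓ ι v hv).2⟩, fun ℓ _ ι ρ hdR => ?_⟩
    obtain ⟨θ, p, q, hinf, T, e, hmod, hρ⟩ := h.2 ℓ ι ρ hdR
    obtain ⟨π, hW, -⟩ := exists_cuspidal_detTwist_glOne hcpt θ
    have hχ := heckeCharacter_detTwist_glOne hW
    subst hρ
    exact ⟨θ, p, q, hinf, T, e, hmod, rfl, π, hχ,
      fun v hv => (h.1 π θ hχ p q hinf T e hmod ℓ ι v hv).2⟩

/-- ★★ **Granting the two named facts of Λ22 §2** (`r_{θ,ι}` is de Rham above `ℓ`; a de Rham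
character is a Weil character — Serre III §2.3 + App. A, Conrad App. B.4, Patrikis Prop. 2.2.1),
**the repaired `n = 1` conjunct over `K` is exactly HT₁**: every cuspidal `π` of `GL₁/K` with Hecke
character `θ` is Hodge–Tate compatible with `r_{θ,ι}` at every `v ∣ ℓ` — by
`R3plus.hodgeTateCompatibleAt_iff_of_hasInfinityType` and `R3plus.hodgeTateCompatibleAt_iff_bdR` the
ε-free statement `HT_τ(r_{θ,ι}|Γ_{K_v}) = {n_{ι∘τ}(θ)}` over Fontaine's `B_dR(K_v)`, Serre's
computation of the Hodge–Tate type of a locally algebraic abelian representation.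
[cite: SerreAbelianLadic1968, III §1.1 and App. A] [cite: BuzzardGeeLMS2014, Rem. 3.2.3]
[cite: Patrikis2019, Prop. 2.2.1] -/
theorem globalLanglandsCorrespondenceGLnR3plus_one_iff_ht_of_facts
    (hDR : HeckeCharacter.exists_lAdic_isDeRhamFramed)
    (hFM : FramedGaloisRep.exists_heckeCharacter_of_isDeRhamFramed) (𝓡 : ReciprocityData K) :
    R3plus.GlobalLanglandsCorrespondenceGLnR3plus 1 K 𝓡 hcpt ↔
      ∀ (π : CuspidalAutomorphicRepData 1 K hcpt) (θ : HeckeCharacter K),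
        (∀ (g : (AdelicGroupData.gl 1 K).Adelic), ∀ φ ∈ π.1.W,
          rightTranslation (AdelicGroupData.gl 1 K) g φ -
            ((θ (Matrix.GeneralLinearGroup.det g) : ℂˣ) : ℂ) • φ ∈ π.1.W') →
        ∀ (p q : InfinitePlace K → ℤ) (hinf : θ.HasInfinityType p q)
          (T : Finset (HeightOneSpectrum (𝓞 K))) (e : HeightOneSpectrum (𝓞 K) → ℕ)
          (hmod : HeckeCharacter.IsModulus θ T e) (ℓ : ℕ) [Fact ℓ.Prime] (ι : PadicAlgCl ℓ ≃+* ℂ)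
          (v : HeightOneSpectrum (𝓞 K)) (hv : ((ℓ : ℕ) : 𝓞 K) ∈ v.asIdeal),
          R3plus.HodgeTateCompatibleAt 𝓡 ι π.1 (hinf.weilRep hmod ι) v hv := by
  rw [globalLanglandsCorrespondenceGLnR3plus_one_iff_weilRep 𝓡]
  refine ⟨fun h π θ hχ p q hinf T e hmod ℓ _ ι v hv => (h.1 π θ hχ p q hinf T e hmod ℓ ι v hv).2,
    fun h => ⟨fun π θ hχ p q hinf T e hmod ℓ _ ι v hv =>
      ⟨isDeRhamFramed_weilRep_of_fact hDR 𝓡 ι hinf hmod v hv, h π θ hχ p q hinf T e hmod ℓ ι v hv⟩,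
      fun ℓ _ ι ρ hdR => exists_eq_weilRep_of_isDeRhamFramed hFM 𝓡 ι ρ hdR⟩⟩

/-- ★★★ **Granting three theorems in print — all about constructed objects — the R3⁺-repaired summit
HOLDS for `n = 1`, for every number field `K` and every reciprocity datum `𝓡`.**  Contrast: granting
the same two named facts, the summit's own `n = 1` conjunct is equivalent to the Weil–Deligne value of
the `Classical.epsilon`-chosen datum on Weil characters (Λ22
`globalLanglandsCorrespondenceGLn_one_iff_wd_of_facts`), which its specification does not determine.
[cite: BuzzardGeeLMS2014, Conj. 3.2.1–3.2.2, Rem. 3.2.3 and Rem. 3.2.5]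
[cite: SerreAbelianLadic1968, III §1.1, §2.3 and App. A] [cite: Patrikis2019, Prop. 2.2.1]
[cite: Conrad2011LiftingGlobal, App. B, Prop. B.4] -/
theorem globalLanglandsCorrespondenceGLnR3plus_one_of_facts
    (hDR : HeckeCharacter.exists_lAdic_isDeRhamFramed)
    (hFM : FramedGaloisRep.exists_heckeCharacter_of_isDeRhamFramed) (𝓡 : ReciprocityData K)
    (hHT : ∀ (π : CuspidalAutomorphicRepData 1 K hcpt) (θ : HeckeCharacter K),
      (∀ (g : (AdelicGroupData.gl 1 K).Adelic), ∀ φ ∈ π.1.W,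
        rightTranslation (AdelicGroupData.gl 1 K) g φ -
          ((θ (Matrix.GeneralLinearGroup.det g) : ℂˣ) : ℂ) • φ ∈ π.1.W') →
      ∀ (p q : InfinitePlace K → ℤ) (hinf : θ.HasInfinityType p q)
        (T : Finset (HeightOneSpectrum (𝓞 K))) (e : HeightOneSpectrum (𝓞 K) → ℕ)
        (hmod : HeckeCharacter.IsModulus θ T e) (ℓ : ℕ) [Fact ℓ.Prime] (ι : PadicAlgCl ℓ ≃+* ℂ)
        (v : HeightOneSpectrum (𝓞 K)) (hv : ((ℓ : ℕ) : 𝓞 K) ∈ v.asIdeal),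
        R3plus.HodgeTateCompatibleAt 𝓡 ι π.1 (hinf.weilRep hmod ι) v hv) :
    R3plus.GlobalLanglandsCorrespondenceGLnR3plus 1 K 𝓡 hcpt :=
  (globalLanglandsCorrespondenceGLnR3plus_one_iff_ht_of_facts hDR hFM 𝓡).mpr
    fun π θ hχ p q hinf T e hmod ℓ _ ι v hv => hHT π θ hχ p q hinf T e hmod ℓ ι v hv

/-- **Granting the two named facts, (A⁺)₁ ⟹ the repaired conjunct**: clause (A⁺) alone already
asserts HT₁ (§2). [cite: BuzzardGeeLMS2014, Conj. 3.2.1–3.2.2] -/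
theorem globalLanglandsCorrespondenceGLnR3plus_one_of_automorphicToGaloisR3plus
    (hDR : HeckeCharacter.exists_lAdic_isDeRhamFramed)
    (hFM : FramedGaloisRep.exists_heckeCharacter_of_isDeRhamFramed) (𝓡 : ReciprocityData K)
    (hA : R3plus.AutomorphicToGaloisR3plus 1 𝓡 hcpt) :
    R3plus.GlobalLanglandsCorrespondenceGLnR3plus 1 K 𝓡 hcpt :=
  globalLanglandsCorrespondenceGLnR3plus_one_of_facts hDR hFM 𝓡
    fun π θ hχ p q hinf T e hmod ℓ _ ι v hv =>
      ((automorphicToGaloisR3plus_one_iff_weilRep 𝓡).mp hA π θ hχ p q hinf T e hmod ℓ ι).2 v hv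

end R3plusOne

end GLOneRigidity

end Summit.Langlands.Langlands.Theorems
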